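import Summits.BirchSwinnertonDyer.BirchSwinnertonDyer.Theorems.ManinLocalTwoThreeQRemainderCalculus
import Literature.NumberTheory.EllipticCurves.ModularCurveEtaProductsProofs
import HarnessLib

/-!
# The Euler functions at level 27: `q`-asymptotics of `E₃, E₉, E₂₇` and of their derivatives;
# Ligozat's `x, u` and `φ₂₇` as `q`-monomials times Euler functions

Cell bsd-f2-manin, route `ManinLocalTwoThree`; second file of the toolkit for the three limits
(T1)–(T3) of `EtaIdentityReduction.abs_maninConstant_eq_one_twentySeven_of_tendsto`.  With
`E_δ(τ) = ∏_{n ≥ 1} (1 − q^{δn})` (`eulerFn δ`) and `q = e^{2πiτ}` we prove, in the remainder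
language of `ManinLocalTwoThreeQRemainderCalculus` (`(f − P(q))/q^m → 0` at `i∞`):

* `E_δ = 1 + o(q^m)` and `E_δ′ = o(q^m)` for `m < δ` (`tendsto_eulerFn`, `tendsto_deriv_eulerFn`; the
  `q`-coefficients of `E_δ` vanish off `δℕ`, and `E_δ − 1` is a cusp function whose derivative has
  `q`-coefficients `2πi n aₙ`);
* `E₃ = 1 − q³ − q⁶ + o(q⁸)` and `E₃′ = 2πi(−3q³ − 6q⁶) + o(q⁸)` (`tendsto_eulerFn_three`,
  `tendsto_deriv_eulerFn_three`; the coefficients `1, −1, −1` of `∏(1 − Xⁿ) = 1 − X − X² + ⋯`);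
* `∏ η(δτ)^{r_δ} = e^{2πiτ Σδr_δ/24} ∏ E_δ^{r_δ}` and hence Ligozat's level-`27` functions
  `x = η(9τ)⁴/(η(3τ)η(27τ)³) = E₉⁴/(q²E₃E₂₇³)`, `u = η(3τ)³/η(27τ)³ = E₃³/(q³E₂₇³)` and the cusp form
  `φ₂₇ = η(3τ)²η(9τ)² = q E₃²E₉²` (`ligozatX_eq`, `ligozatU_eq`, `etaProductTwentySeven_eq`).
-/

set_option autoImplicit false

noncomputable section

open Complex Filter Topology Set Asymptotics Polynomial
open UpperHalfPlane hiding I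
open scoped Real Topology Manifold MatrixGroups
open Literature.NumberTheory.EllipticCurves Literature.NumberTheory.EllipticCurves.ModularForms

namespace Summit.BirchSwinnertonDyer.BirchSwinnertonDyer.Theorems.ManinLocalTwoThree.EulerRemainders

open QRemainder

/-! ## 1. The Euler functions `E_δ = ∏ (1 − q^{δn})` as cusp functions shifted by `1` -/

/-- `E_δ − 1` is a cusp function of period `1` (`δ ≥ 1`). [folklore] -/
theorem isCuspFunction_eulerFn_sub_one {δ : ℕ} (hδ : 0 < δ) : IsCuspFunction 1 (eulerFn δ - 1) where
  pos := one_pos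
  periodic := fun z ↦ by
    have := periodic_eulerFn δ z
    simp only [Function.comp_apply, Pi.sub_apply, Pi.one_apply, Complex.ofReal_one] at this ⊢
    rw [this]
  mdifferentiable := (mdifferentiable_eulerFn δ).sub mdifferentiable_const
  isZeroAtImInfty := by
    have h := (isIntUnitQExp_eulerFn hδ).tendsto_one.sub_const 1
    rw [sub_self] at h
    exact h

/-- For `n ≥ 1` the `q`-coefficients of `E_δ − 1` and `E_δ` agree. [folklore] -/
theorem qExpansion_eulerFn_sub_one_coeff_of_ne_zero {δ n : ℕ} (hδ : 0 < δ) (hn : n ≠ 0) :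
    (qExpansion 1 (eulerFn δ - 1)).coeff n = ((PowerSeries.coeff n (formalEulerScaled δ) : ℤ) : ℂ) := by
  have han := (isIntUnitQExp_eulerFn hδ).analyticAt
  have h1 : AnalyticAt ℂ (cuspFunction 1 (1 : ℍ → ℂ)) 0 := IsIntUnitQExp.one.analyticAt
  rw [qExpansion_sub han h1, map_sub, qExpansion_one, PowerSeries.coeff_one, if_neg hn, sub_zero,
    qExpansion_eulerFn hδ, PowerSeries.coeff_map, Int.coe_castRingHom]

/-- `d/dτ (E_δ − 1) = d/dτ E_δ`. [folklore] -/
theorem deriv_eulerFn_sub_one (δ : ℕ) (z : ℂ) :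
    deriv ((eulerFn δ - 1) ∘ ofComplex) z = deriv (eulerFn δ ∘ ofComplex) z := by
  have : (eulerFn δ - 1) ∘ ofComplex = fun w ↦ (eulerFn δ ∘ ofComplex) w - 1 := by
    funext w; simp
  rw [this, deriv_sub_const]

/-! ## 2. `E_δ = 1 + o(q^m)` and `E_δ′ = o(q^m)` for `m < δ` -/

/-- **`E_δ = 1 + o(q^m)` for `m < δ`.** [folklore] -/
theorem tendsto_eulerFn {δ m : ℕ} (hm : m < δ) :
    Tendsto (fun τ : ℍ ↦ (eulerFn δ τ - (1 : ℂ[X]).eval (Function.Periodic.qParam 1 (τ : ℂ)))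
      / Function.Periodic.qParam 1 (τ : ℂ) ^ m) atImInfty (𝓝 0) := by
  have hδ : 0 < δ := by omega
  refine congr_poly ?_ (tendsto_of_hasSum (periodic_eulerFn δ) (mdifferentiable_eulerFn δ)
    (isBoundedAtImInfty_eulerFn hδ) (hasSum_eulerFn hδ) m)
  rw [Finset.sum_eq_single 0 (fun n hn h0 ↦ ?_) (fun h ↦ absurd (Finset.mem_range.mpr (by omega)) h)]
  · simp [PowerSeries.coeff_zero_eq_constantCoeff]
  · have hnd : ¬ δ ∣ n := Nat.not_dvd_of_pos_of_lt (Nat.pos_of_ne_zero h0)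
      (lt_of_le_of_lt (Nat.lt_succ_iff.mp (Finset.mem_range.mp hn)) hm)
    rw [coeff_formalEulerScaled, if_neg hnd, Int.cast_zero, map_zero, zero_mul]

/-- **`E_δ′ = o(q^m)` for `m < δ`.** [folklore] -/
theorem tendsto_deriv_eulerFn {δ m : ℕ} (hm : m < δ) :
    Tendsto (fun τ : ℍ ↦ (deriv (eulerFn δ ∘ ofComplex) τ
      - (0 : ℂ[X]).eval (Function.Periodic.qParam 1 (τ : ℂ)))
      / Function.Periodic.qParam 1 (τ : ℂ) ^ m) atImInfty (𝓝 0) := by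
  have hδ : 0 < δ := by omega
  refine congr_poly ?_ (congr_fun (fun τ ↦ deriv_eulerFn_sub_one δ τ)
    (tendsto_deriv_of_isCuspFunction (isCuspFunction_eulerFn_sub_one hδ) m))
  refine Finset.sum_eq_zero fun n hn ↦ ?_
  rw [EtaAsymptotics.qExpansion_eulerFn_sub_one_coeff hδ
    (lt_of_le_of_lt (Nat.lt_succ_iff.mp (Finset.mem_range.mp hn)) hm), mul_zero, map_zero, zero_mul]

/-! ## 3. `E₃ = 1 − q³ − q⁶ + o(q⁸)` and `E₃′ = 2πi(−3q³ − 6q⁶) + o(q⁸)` -/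

/-- `∏ (1 − Xⁿ) = 1 − X − X² + ⋯`: the coefficients `0, 1, 2` are `1, −1, −1`. [folklore] -/
theorem coeff_formalEulerPow_one_of_le_two :
    PowerSeries.coeff 0 (formalEulerPow 1) = 1 ∧ PowerSeries.coeff 1 (formalEulerPow 1) = -1 ∧
      PowerSeries.coeff 2 (formalEulerPow 1) = -1 := by
  have h2 : eulerTrunc 1 2 = 1 - PowerSeries.X - PowerSeries.X ^ 2 + PowerSeries.X ^ 3 := by
    rw [eulerTrunc, Finset.prod_range_succ, Finset.prod_range_succ, Finset.prod_range_zero]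
    ring
  refine ⟨?_, ?_, ?_⟩
  · rw [PowerSeries.coeff_zero_eq_constantCoeff_apply, constantCoeff_formalEulerPow]
  · rw [coeff_formalEulerPow (show 1 ≤ 2 by norm_num), h2]
    simp [PowerSeries.coeff_X_pow, PowerSeries.coeff_X]
  · rw [coeff_formalEulerPow (le_refl 2), h2]
    simp [PowerSeries.coeff_X_pow, PowerSeries.coeff_X]

/-- The first nine `q`-coefficients of `E₃`: `1, 0, 0, −1, 0, 0, −1, 0, 0`. [folklore] -/
theorem coeff_formalEulerScaled_three (n : ℕ) (hn : n ≤ 8) :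
    PowerSeries.coeff n (formalEulerScaled 3)
      = if n = 0 then 1 else if n = 3 then -1 else if n = 6 then -1 else 0 := by
  obtain ⟨h0, h1, h2⟩ := coeff_formalEulerPow_one_of_le_two
  interval_cases n <;> simp +decide [coeff_formalEulerScaled, h0, h1, h2]

/-- **`E₃ = 1 − q³ − q⁶ + o(q⁸)`.** [folklore] -/
theorem tendsto_eulerFn_three :
    Tendsto (fun τ : ℍ ↦ (eulerFn 3 τ - (1 - X ^ 3 - X ^ 6 : ℂ[X]).eval (Function.Periodic.qParam 1 (τ : ℂ)))
      / Function.Periodic.qParam 1 (τ : ℂ) ^ 8) atImInfty (𝓝 0) := by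
  refine congr_poly ?_ (tendsto_of_hasSum (periodic_eulerFn 3) (mdifferentiable_eulerFn 3)
    (isBoundedAtImInfty_eulerFn (by norm_num)) (hasSum_eulerFn (by norm_num)) 8)
  have h := coeff_formalEulerScaled_three
  simp only [Finset.sum_range_succ, Finset.sum_range_zero, h 0 (by norm_num), h 1 (by norm_num),
    h 2 (by norm_num), h 3 (by norm_num), h 4 (by norm_num), h 5 (by norm_num), h 6 (by norm_num),
    h 7 (by norm_num), h 8 (by norm_num)]
  norm_num
  ring

/-- **`E₃′ = 2πi(−3q³ − 6q⁶) + o(q⁸)`** (`θ = q d/dq` acts by `Σ aₙqⁿ ↦ Σ n aₙ qⁿ`). [folklore] -/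
theorem tendsto_deriv_eulerFn_three :
    Tendsto (fun τ : ℍ ↦ (deriv (eulerFn 3 ∘ ofComplex) τ
      - (C (2 * π * I) * (-3 * X ^ 3 - 6 * X ^ 6) : ℂ[X]).eval (Function.Periodic.qParam 1 (τ : ℂ)))
      / Function.Periodic.qParam 1 (τ : ℂ) ^ 8) atImInfty (𝓝 0) := by
  refine congr_poly ?_ (congr_fun (fun τ ↦ deriv_eulerFn_sub_one 3 τ)
    (tendsto_deriv_of_isCuspFunction (isCuspFunction_eulerFn_sub_one (by norm_num : 0 < 3)) 8))
  have h := coeff_formalEulerScaled_three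
  have hc : ∀ n : ℕ, n ≠ 0 → n ≤ 8 → (qExpansion 1 (eulerFn 3 - 1)).coeff n
      = (((if n = 0 then 1 else if n = 3 then -1 else if n = 6 then -1 else 0 : ℤ)) : ℂ) :=
    fun n hn hn8 ↦ by rw [qExpansion_eulerFn_sub_one_coeff_of_ne_zero (by norm_num) hn, h n hn8]
  simp only [Finset.sum_range_succ, Finset.sum_range_zero, hc 1 one_ne_zero (by norm_num),
    hc 2 (by norm_num) (by norm_num), hc 3 (by norm_num) (by norm_num), hc 4 (by norm_num) (by norm_num),
    hc 5 (by norm_num) (by norm_num), hc 6 (by norm_num) (by norm_num), hc 7 (by norm_num) (by norm_num),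
    hc 8 (by norm_num) (by norm_num)]
  norm_num
  simp only [map_ofNat]
  ring

/-! ## 4. Ligozat's functions `x, u` and `φ₂₇` in terms of `q` and the Euler functions -/

/-- **`∏ η(δτ)^{r_δ} = e^{2πiτ Σδr_δ/24} ∏ E_δ^{r_δ}`.** [folklore] -/
theorem etaQuotient_eq_cexp_mul_prod (N : ℕ) (r : ℕ → ℤ) (τ : ℍ) :
    etaQuotient N r τ = cexp (2 * π * I * τ / 24 * ((∑ δ ∈ N.divisors, (δ : ℤ) * r δ : ℤ) : ℂ))
      * ∏ δ ∈ N.divisors, eulerFn δ τ ^ r δ := by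
  rw [etaQuotient_apply]
  simp_rw [eta_natMul_eq_qParam_mul_eulerFn, mul_zpow, Finset.prod_mul_distrib]
  have hq : ∀ δ : ℕ, Function.Periodic.qParam 24 ((δ : ℂ) * τ) ^ (r δ) =
      cexp (2 * π * I * τ / 24 * (((δ : ℤ) * r δ : ℤ) : ℂ)) := fun δ ↦ by
    rw [Function.Periodic.qParam, ← Complex.exp_int_mul]
    congr 1
    push_cast
    ring
  simp_rw [hq]
  rw [← Complex.exp_sum, ← Finset.mul_sum, ← Int.cast_sum]

/-- `e^{2πiτ·(−24k)/24} = q^{−k}`. [folklore] -/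
theorem cexp_neg_eq_inv_qParam_pow (τ : ℍ) (k : ℕ) :
    cexp (2 * π * I * τ / 24 * ((-(24 * k : ℕ) : ℤ) : ℂ)) = (Function.Periodic.qParam 1 (τ : ℂ) ^ k)⁻¹ := by
  rw [Function.Periodic.qParam, ← Complex.exp_nat_mul, ← Complex.exp_neg]
  congr 1
  push_cast
  ring

/-- **`x = η(9τ)⁴/(η(3τ)η(27τ)³) = E₉⁴/(q² E₃ E₂₇³)`.** [folklore] -/
theorem ligozatX_eq (τ : ℍ) :
    etaQuotient 27 (expFn [(3, -1), (9, 4), (27, -3)]) τ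
      = eulerFn 9 τ ^ 4 / (Function.Periodic.qParam 1 (τ : ℂ) ^ 2 * eulerFn 3 τ * eulerFn 27 τ ^ 3) := by
  have hE3 := eulerFn_ne_zero (by norm_num : 0 < 3) τ
  have hE27 := eulerFn_ne_zero (by norm_num : 0 < 27) τ
  have hq := qParam_ne_zero τ
  rw [etaQuotient_eq_cexp_mul_prod, show Nat.divisors 27 = {1, 3, 9, 27} by decide]
  have hsum : (∑ δ ∈ ({1, 3, 9, 27} : Finset ℕ), (δ : ℤ) * expFn [(3, -1), (9, 4), (27, -3)] δ)
      = (-(24 * 2 : ℕ) : ℤ) := by decide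
  rw [hsum, cexp_neg_eq_inv_qParam_pow]
  rw [Finset.prod_insert (by decide), Finset.prod_insert (by decide), Finset.prod_insert (by decide),
    Finset.prod_singleton]
  rw [show expFn [(3, -1), (9, 4), (27, -3)] 1 = 0 by decide,
    show expFn [(3, -1), (9, 4), (27, -3)] 3 = -1 by decide,
    show expFn [(3, -1), (9, 4), (27, -3)] 9 = 4 by decide,
    show expFn [(3, -1), (9, 4), (27, -3)] 27 = -3 by decide]
  simp only [zpow_neg, zpow_ofNat]
  field_simp

/-- **`u = η(3τ)³/η(27τ)³ = E₃³/(q³ E₂₇³)`.** [folklore] -/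
theorem ligozatU_eq (τ : ℍ) :
    etaQuotient 27 (expFn [(3, 3), (27, -3)]) τ
      = eulerFn 3 τ ^ 3 / (Function.Periodic.qParam 1 (τ : ℂ) ^ 3 * eulerFn 27 τ ^ 3) := by
  have hE27 := eulerFn_ne_zero (by norm_num : 0 < 27) τ
  have hq := qParam_ne_zero τ
  rw [etaQuotient_eq_cexp_mul_prod, show Nat.divisors 27 = {1, 3, 9, 27} by decide]
  have hsum : (∑ δ ∈ ({1, 3, 9, 27} : Finset ℕ), (δ : ℤ) * expFn [(3, 3), (27, -3)] δ)
      = (-(24 * 3 : ℕ) : ℤ) := by decide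
  rw [hsum, cexp_neg_eq_inv_qParam_pow]
  rw [Finset.prod_insert (by decide), Finset.prod_insert (by decide), Finset.prod_insert (by decide),
    Finset.prod_singleton]
  rw [show expFn [(3, 3), (27, -3)] 1 = 0 by decide,
    show expFn [(3, 3), (27, -3)] 3 = 3 by decide,
    show expFn [(3, 3), (27, -3)] 9 = 0 by decide,
    show expFn [(3, 3), (27, -3)] 27 = -3 by decide]
  simp only [zpow_neg, zpow_ofNat]
  field_simp

/-- **`φ₂₇ = η(3τ)²η(9τ)² = q E₃² E₉²`.** [folklore] -/
theorem etaProductTwentySeven_eq (τ : ℍ) :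
    cuspFormEtaProductTwentySeven τ
      = Function.Periodic.qParam 1 (τ : ℂ) * eulerFn 3 τ ^ 2 * eulerFn 9 τ ^ 2 := by
  rw [show (cuspFormEtaProductTwentySeven τ : ℂ) = etaProductTwentySeven τ from rfl,
    etaProductTwentySeven_apply]
  have h3 := eta_natMul_eq_qParam_mul_eulerFn 3 τ
  have h9 := eta_natMul_eq_qParam_mul_eulerFn 9 τ
  push_cast at h3 h9
  rw [h3, h9]
  have hq : Function.Periodic.qParam 24 (3 * (τ : ℂ)) ^ 2 * Function.Periodic.qParam 24 (9 * (τ : ℂ)) ^ 2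
      = Function.Periodic.qParam 1 (τ : ℂ) := by
    simp only [Function.Periodic.qParam, ← Complex.exp_nat_mul, ← Complex.exp_add]
    congr 1
    push_cast
    ring
  rw [← hq]
  ring

end Summit.BirchSwinnertonDyer.BirchSwinnertonDyer.Theorems.ManinLocalTwoThree.EulerRemainders

end
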